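import Mathlib
import Literature.RepresentationTheory.FiniteGroups.WedderburnBlocks
import Literature.RepresentationTheory.FiniteGroups.FourierInversionIdentity
import Literature.Computability.AlgebraicComplexity.BCGPUInfiniteGroupsProofs
import Summits.MatrixMultiplication.MatrixMultiplication.Theses.LevelGradedCohnUmans

/-!
# Sketch — crux idea `fourier-support-repfun` for `GradedPricing` (stmt-MatrixMultiplication-7611)

First lemma + transfer statement + the remaining (routine) signatures of the line, to make sure
they elaborate over existing declarations. Proofs are `sorry` (ideation stage; no skeleton yet).
-/

noncomputable section
open scoped BigOperators Pointwise

namespace Summit.MatrixMultiplication.MatrixMultiplication.Cruxes.GradedPricing.FourierSupportRepFun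

open Literature.RepresentationTheory.FiniteGroups
open Literature.Computability.AlgebraicComplexity

variable {G : Type} [Group G]

/-- The inversion-twisted Fourier lift `f ↦ f̌ := ∑_g f(g⁻¹)·g ∈ ℂ[G]`; it turns the read-out
functional into the trace form: `(f̌ * u).coeff 1 = ∑_g f(g) u(g)`, and bi-invariant `J` into a
two-sided ideal `J̌`. -/
def invLift [Fintype G] (f : G → ℂ) : MonoidAlgebra ℂ G :=
  ∑ g : G, MonoidAlgebra.single g (f g⁻¹)

variable {r : ℕ} {d : Fin r → ℕ}

/-- The `i`-th Wedderburn block as a `GL`-valued matrix representation (for `repFun`). -/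
def blockUnitsRep (φ : MonoidAlgebra ℂ G ≃ₐ[ℂ] BlockAlgebraC d) (i : Fin r) :
    G →* Matrix.GeneralLinearGroup (Fin (d i)) ℂ :=
  ((((Pi.evalAlgHom ℂ (fun i : Fin r => Matrix (Fin (d i)) (Fin (d i)) ℂ) i).comp
    φ.toAlgHom).toMonoidHom).comp (MonoidAlgebra.of ℂ G)).toHomUnits

/-- The read-out functional is a coefficient of a product: `(f̌ · g).coeff 1 = f(g)`. PROVED. -/
theorem coeff_one_invLift_mul_single [Fintype G] [DecidableEq G] (f : G → ℂ) (g : G) :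
    (invLift f * MonoidAlgebra.single g 1).coeff 1 = f g := by
  simp only [invLift, Finset.sum_mul, MonoidAlgebra.single_mul_single, mul_one,
    MonoidAlgebra.coeff_sum, MonoidAlgebra.coeff_single, Finset.sum_apply', Finsupp.single_apply]
  rw [Finset.sum_eq_single g⁻¹]
  · simp
  · intro h _ hne
    rw [if_neg]
    intro e
    exact hne (eq_inv_of_mul_eq_one_left e)
  · simp

/-- Bi-translation becomes two-sided multiplication: `a · ȟ · b = ǩ` with `k(x) = h(b x a)`;
so a bi-invariant `J` has a two-sided ideal `J̌` as image. PROVED (convention check). -/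
theorem single_mul_invLift_mul_single [Fintype G] (h : G → ℂ) (a b : G) :
    MonoidAlgebra.single a 1 * invLift h * MonoidAlgebra.single b 1 =
      invLift (fun x => h (b * x * a)) := by
  simp only [invLift, Finset.mul_sum, Finset.sum_mul, MonoidAlgebra.single_mul_single, one_mul,
    mul_one]
  exact Fintype.sum_equiv ((Equiv.mulLeft a).trans (Equiv.mulRight b)) _ _ fun x => by
    simp [mul_assoc]

/-- Read-out = trace form (Fourier inversion at `1`, in-tree `card_mul_coeff_one_eq_sum_trace`):
`|G| · f(g) = ∑_i d_i · tr (φ(f̌)_i · φ(g)_i)`. PROVED (toy check of the lever). -/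
theorem card_mul_apply_eq_sum_trace [Fintype G] [DecidableEq G]
    (φ : MonoidAlgebra ℂ G ≃ₐ[ℂ] BlockAlgebraC d) (f : G → ℂ) (g : G) :
    (Fintype.card G : ℂ) * f g =
      ∑ i, (d i : ℂ) * Matrix.trace (φ (invLift f) i * φ (MonoidAlgebra.single g 1) i) := by
  have h := card_mul_coeff_one_eq_sum_trace φ (invLift f * MonoidAlgebra.single g 1)
  rw [coeff_one_invLift_mul_single] at h
  rw [h]
  simp only [map_mul, Pi.mul_apply]

/-- **FIRST LEMMA (Fourier-support lemma).** If `J` is bi-invariant and some `f ∈ J` has a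
non-zero `i`-th Fourier coefficient `φ(f̌)_i ≠ 0`, then the block character `χ_i` lies in `J`
(`J̌` is a two-sided ideal of `ℂ[G]`; matrix units make `φ(J̌) ⊇ block i`, so `e_i ∈ J̌`, and the
function with lift `e_i` is `(d_i/|G|) χ_i` by Fourier inversion at `1`). -/
theorem character_mem_of_fourierCoeff_ne_zero [Fintype G] [∀ i, NeZero (d i)]
    (φ : MonoidAlgebra ℂ G ≃ₐ[ℂ] BlockAlgebraC d) (J : Submodule ℂ (G → ℂ))
    (hJ : ∀ f ∈ J, ∀ a b : G, (fun g : G => f (a * g * b)) ∈ J)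
    {f : G → ℂ} (hf : f ∈ J) {i : Fin r} (hi : φ (invLift f) i ≠ 0) :
    (blockRep φ i).character ∈ J := by
  sorry

open Classical in
/-- **TRANSFER `C⁺` (Peter–Weyl containment).** A bi-invariant `J` consists of representative
functions of the Wedderburn blocks whose characters it contains. -/
theorem le_repFun_charSupport [Fintype G] [∀ i, NeZero (d i)]
    (φ : MonoidAlgebra ℂ G ≃ₐ[ℂ] BlockAlgebraC d) (J : Submodule ℂ (G → ℂ))
    (hJ : ∀ f ∈ J, ∀ a b : G, (fun g : G => f (a * g * b)) ∈ J) :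
    J ≤ repFun (fun i : {i : Fin r // (blockRep φ i).character ∈ J} => d i.1)
      (fun i => blockUnitsRep φ i.1) := by
  sorry

open Classical in
/-- Budget comparison: the blocks with `χ_i ∈ J` are priced by the crux's right-hand side
(distinct irreducible characters, `character_blockRep_injective`, `irrChars_finite_holds`). -/
theorem sum_charSupport_rpow_le [Fintype G] [∀ i, NeZero (d i)]
    (φ : MonoidAlgebra ℂ G ≃ₐ[ℂ] BlockAlgebraC d) (J : Submodule ℂ (G → ℂ)) (s : ℝ) :
    ∑ i : {i : Fin r // (blockRep φ i).character ∈ J}, ((d i.1 : ℕ) : ℝ) ^ s ≤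
      ∑ᶠ χ ∈ irrChars G ∩ (J : Set (G → ℂ)), (χ 1).re ^ s := by
  sorry

/-- Dictionary: the crux's separation (word `x⁻¹ y y'⁻¹ z`, Kronecker target) gives, for the
inverted sets, the embedding TPP and a separating family (BCGPU Def. 2.1) inside `J`
(needs `Y ≠ ∅` for the value-`1` clause; `Y = ∅` makes the crux trivial). -/
theorem sep_inv_dictionary [DecidableEq G] (J : Set (G → ℂ)) (X Y Z : Finset G)
    (hY : Y.Nonempty)
    (hsep : ∀ x₀ ∈ X, ∀ z₀ ∈ Z, ∃ f ∈ J, ∀ x ∈ X, ∀ y ∈ Y, ∀ y' ∈ Y, ∀ z ∈ Z,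
      (x = x₀ ∧ y = y' ∧ z = z₀ → f (x⁻¹ * y * y'⁻¹ * z) = 1) ∧
      (¬ (x = x₀ ∧ y = y' ∧ z = z₀) → f (x⁻¹ * y * y'⁻¹ * z) = 0)) :
    (∀ x ∈ X⁻¹, ∀ x' ∈ X⁻¹, ∀ y ∈ Y⁻¹, ∀ y' ∈ Y⁻¹, ∀ z ∈ Z⁻¹, ∀ z' ∈ Z⁻¹,
      x * y⁻¹ * y' * z⁻¹ = x' * z'⁻¹ → x = x' ∧ y = y' ∧ z = z') ∧
    ∃ f : G → G → (G → ℂ), IsSeparatingFamily X⁻¹ Y⁻¹ Z⁻¹ f ∧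
      ∀ x ∈ X⁻¹, ∀ z ∈ Z⁻¹, f x z ∈ J := by
  sorry

/-! ### Card 2 (`reynolds-character-extraction`): the same support lemma by AVERAGING OPERATORS

Right shift by `a` (right-invariance), conjugation expectation (Schur: an intertwiner of the
irreducible `blockRep φ i` is a scalar — Mathlib
`Representation.IsIrreducible.algebraMap_intertwiningMap_bijective_of_isAlgClosed`, as used by the
tree's `exists_isotypicProj_eq_smul_id`), then convolution with `χᵢ(g⁻¹)` (the isotypic projector of
the left-regular representation; tree `isotypicProj_eq_id_of_character_eq` / `_eq_zero_of_character_ne`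
on the blocks) extract `χᵢ` from ANY `f` as an explicit combination of `|G|²` bi-translates. -/

/-- **FIRST LEMMA of card 2 (character extraction formula).**
`Σ_{g,h} χᵢ(g⁻¹) · f(h·g·x·h⁻¹·a) = (|G|/dᵢ) · tr(φ(a)ᵢ · φ(f̌)ᵢ) · χᵢ(x)`. -/
theorem character_extraction_by_averaging [Fintype G] [DecidableEq G] [∀ i, NeZero (d i)]
    (φ : MonoidAlgebra ℂ G ≃ₐ[ℂ] BlockAlgebraC d) (f : G → ℂ) (i : Fin r) (a : G) :
    (fun x : G => ∑ g : G, ∑ h : G, (blockRep φ i).character g⁻¹ * f (h * g * x * h⁻¹ * a)) =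
      ((Fintype.card G : ℂ) / (d i : ℂ) *
          Matrix.trace (φ (MonoidAlgebra.single a 1) i * φ (invLift f) i)) •
        (blockRep φ i).character := by
  sorry

/-- Non-degeneracy: a non-zero Fourier coefficient is seen by some right shift
(`{φ(a)ᵢ : a ∈ G}` spans the block because `φ` is onto; the trace form on `M_d(ℂ)` is perfect). -/
theorem exists_trace_single_mul_ne_zero [Fintype G] [∀ i, NeZero (d i)]
    (φ : MonoidAlgebra ℂ G ≃ₐ[ℂ] BlockAlgebraC d) {i : Fin r}
    {M : Matrix (Fin (d i)) (Fin (d i)) ℂ} (hM : M ≠ 0) :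
    ∃ a : G, Matrix.trace (φ (MonoidAlgebra.single a 1) i * M) ≠ 0 := by
  sorry

/-- Card 2's form of the support lemma (corollary of the two statements above: the left-hand side
of the extraction formula is a finite sum of bi-translates of `f`, hence lies in `J`). -/
theorem character_mem_of_fourierCoeff_ne_zero' [Fintype G] [DecidableEq G] [∀ i, NeZero (d i)]
    (φ : MonoidAlgebra ℂ G ≃ₐ[ℂ] BlockAlgebraC d) (J : Submodule ℂ (G → ℂ))
    (hJ : ∀ f ∈ J, ∀ a b : G, (fun g : G => f (a * g * b)) ∈ J)
    {f : G → ℂ} (hf : f ∈ J) {i : Fin r} (hi : φ (invLift f) i ≠ 0) :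
    (blockRep φ i).character ∈ J := by
  classical
  obtain ⟨a, ha⟩ := exists_trace_single_mul_ne_zero φ hi
  have hmem : (fun x : G => ∑ g : G, ∑ h : G,
      (blockRep φ i).character g⁻¹ * f (h * g * x * h⁻¹ * a)) ∈ J := by
    have : (fun x : G => ∑ g : G, ∑ h : G,
        (blockRep φ i).character g⁻¹ * f (h * g * x * h⁻¹ * a)) =
        ∑ g : G, ∑ h : G, (blockRep φ i).character g⁻¹ • (fun x : G => f ((h * g) * x * (h⁻¹ * a))) := by
      funext x
      simp only [Finset.sum_apply, Pi.smul_apply, smul_eq_mul]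
      refine Finset.sum_congr rfl fun g _ => Finset.sum_congr rfl fun h _ => ?_
      congr 1
      group
    rw [this]
    exact Submodule.sum_mem _ fun g _ => Submodule.sum_mem _ fun h _ =>
      Submodule.smul_mem _ _ (hJ f hf (h * g) (h⁻¹ * a))
  rw [character_extraction_by_averaging φ f i a] at hmem
  have hc : ((Fintype.card G : ℂ) / (d i : ℂ) *
      Matrix.trace (φ (MonoidAlgebra.single a 1) i * φ (invLift f) i)) ≠ 0 := by
    refine mul_ne_zero (div_ne_zero ?_ ?_) ha
    · exact_mod_cast Fintype.card_ne_zero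
    · exact_mod_cast NeZero.ne (d i)
  have := Submodule.smul_mem J (((Fintype.card G : ℂ) / (d i : ℂ) *
      Matrix.trace (φ (MonoidAlgebra.single a 1) i * φ (invLift f) i))⁻¹) hmem
  rwa [smul_smul, inv_mul_cancel₀ hc, one_smul] at this

/-- The line concludes the crux BY NAME (composition with the in-tree
`BCGPU2024_thm_2_2_corrected_holds`; to be made a checked skeleton at crux-plan). -/
theorem GradedPricing_of_sketch :
    Summit.MatrixMultiplication.MatrixMultiplication.Theses.LevelGradedCohnUmans.GradedPricing := by
  intro G _ _ J hJ X Y Z hsep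
  have hthm := @BCGPU2024_thm_2_2_corrected_holds.{0}
  obtain ⟨r, d, hd, ⟨φ⟩⟩ := exists_algEquiv_pi_matrix G
  sorry

end Summit.MatrixMultiplication.MatrixMultiplication.Cruxes.GradedPricing.FourierSupportRepFun

end
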